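import Summits.BirchSwinnertonDyer.BirchSwinnertonDyer.Theorems.MordellShaFreeCutExistenceFromTwoFacts
import Summits.BirchSwinnertonDyer.BirchSwinnertonDyer.Theorems.MordellShaFreeCutKatoZetaRoadOddDiscCensus
import Summits.BirchSwinnertonDyer.BirchSwinnertonDyer.Theorems.MordellShaFreeCutBDPWaldspurgerFormula
import Summits.BirchSwinnertonDyer.BirchSwinnertonDyer.Theorems.MordellShaFreeCutKatoBDPReciprocity
import Summits.BirchSwinnertonDyer.BirchSwinnertonDyer.Theorems.MordellShaFreeCutThreeAdicBDPExistsValue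
import HarnessLib

set_option linter.dupNamespace false -- `Summit.BirchSwinnertonDyer.BirchSwinnertonDyer.Theorems.…` (summit = sub)
set_option autoImplicit false

/-! # Route `MordellShaFreeCut` (rung S2b) — END-STATE CENSUS of BOTH roads to crux B with ONE NAMED `Prop` PER RESEARCH
INPUT: existence [(T1) + BDP13, citation-borne at odd `d_K`] · value [`BDPWaldspurgerFormula 3`] · reciprocity [(ERL₃)
`ThreeAdicKatoBDPReciprocity`] or divisibility [(LB-wan) `ThreeAdicWanDivisibility`]

Cell `bsd-cn100`, prover seat `bsd-cn100-s2b-c3` (g9). Supports, does not close, stmt-BirchSwinnertonDyer-19160 (crux B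
`AnalyticRankOneOfRankOneFiniteShaThree`, registered line `kato-zeta-perrin-riou` v1e {`stub_refereedInputs` (9 conjuncts),
`stub_prFormulaAtThree : PRFormulaAtThreeH2`}); serves stmt-19159 (crux A, registered line v6br2). THEOREMS ONLY — one-line
compositions of LANDED tree theorems; 0 `def`, 0 new named fact. The S2b twin of bsd-cn100-s2-c3 g10's
`CongruentShaFreeCutKatoZetaRoadNamedPropsCensus` (p496725) and of bsd-cn100-transfer g11's `cruxB_of_exists_of_waldspurger_of_wan`
(p490840): every census of the g8 pack (`MordellShaFreeCutExistenceFromTwoFacts`, `…KatoZetaRoadOddDiscCensus`,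
`…RoadsMeetFromPrint`) carries the VALUE input as the ∀-frame statement (LB-bdp) `ThreeAdicBDPValueAtOne`; since transfer g11's
p491259 `MordellShaFreeCutBDPWaldspurgerFormula.threeAdicBDPValueAtOne_of_waldspurger` that statement is the `p = 3`, `j = 0`
specialisation of the ONE named `Prop` `BDPWaldspurgerFormula 3` (the generalised `p`-adic Waldspurger / BDP formula at the
trivial character for the EXACT frame, value up to a unit of `R₀`; IN PRINT for `p ∤ N`, `p ≠ 2` — BDP 2013 Thm. 5.13 /
CGLS 2022 Thm. 5.1.3; OPEN at the additive prime `3` of the `j = 0` curves). This file re-issues the censuses with that `Prop`: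

* §1 `prFormulaOddDisc_of_anyLevel_of_bdp2013_of_waldspurger_of_reciprocity` — Perrin-Riou's formula at the Heegner fields of
  ODD discriminant (all the registered 19160 line uses, p493654) ⟸ {(T1), BDP13} + `BDPWaldspurgerFormula 3` + (ERL₃);
  `prFormulaAtThreeH2_of_exists_of_waldspurger_of_reciprocity` — the REGISTERED research stub's type `PRFormulaAtThreeH2`
  (all Heegner fields) ⟸ (LB-exist) `ThreeAdicBDPElementExists` + `BDPWaldspurgerFormula 3` + (ERL₃).
* §2 kato-zeta road: `cruxB_of_refereedInputs_of_anyLevel_of_bdp2013_of_waldspurger_of_reciprocity` — the v1e bundle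
  `stub_refereedInputs` TOKEN FOR TOKEN ∧ (T1) ∧ BDP13 ∧ `BDPWaldspurgerFormula 3` ∧ (ERL₃) ⟹ crux B; and the same with
  (LB-exist) in place of {(T1), BDP13} (`…_of_exists_of_waldspurger_of_reciprocity`).
* §3 BDP road: `cruxB_of_anyLevel_of_bdp2013_of_waldspurger_of_wan` (six refereed facts ∧ (T1) ∧ BDP13 ∧
  `BDPWaldspurgerFormula 3` ∧ (LB-wan) ⟹ crux B), `cruxA_of_res_of_anyLevel_of_bdp2013_of_waldspurger_of_wan` (= the
  REGISTERED v6br2 composition of 19159 with its value stub fed by the Waldspurger `Prop`), and the leaf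
  `leaf_of_res_of_anyLevel_of_bdp2013_of_waldspurger_of_wan`.
* §4 joined road, fully named: `cruxB_of_namedFacts_of_anyLevel_of_bdp2013_of_waldspurger_of_reciprocity` — crux B ⟸ ELEVEN
  citation-borne named facts {six refereed theorems; `nonempty_iwasawaH2Data`, `thm12_4`, `finite_descentCokernel_of_rankOne`;
  (T1); BDP13} + `BDPWaldspurgerFormula 3` + (ERL₃).

NET (honest count for the plan's text, BY NAME): the research content of item 19160 modulo its citation-borne inputs is, on
EITHER road, {`BDPWaldspurgerFormula 3`} ∪ ONE of {(ERL₃) `ThreeAdicKatoBDPReciprocity` [kato-zeta], (LB-wan)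
`ThreeAdicWanDivisibility` [BDP]} (existence citation-borne from {(T1), BDP13} at the odd-`d_K` Heegner fields the plumbing
chooses, or the stub (LB-exist) at all Heegner fields); item 19159 adds (res). HONEST FRAMING: CONDITIONAL compositions; nothing
here proves `BDPWaldspurgerFormula 3`, (ERL₃), (LB-wan), (res), Perrin-Riou's formula, crux A/B, the leaf
`rankOne_threeConverse_mordellCurve`, Sylvester's conjecture or any case of BSD. PARTITION: none — RANK axis.
[cite: BertoliniDarmonPrasanna2013, Thm. 5.13 (shape) and Thm. 5.5] [cite: CastellaGrossiLeeSkinner2022, Thm. 5.1.3 and §5.2]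
[cite: Hsieh2014, Thm. A p. 712] [cite: AlpogeBhargavaShnidman2022, App. A Thm. 10.1, Thm. 10.8 (pp. 33–34)]
[cite: Kato2004Asterisque, Thm. 12.4 (p. 221), (14.9.3) (p. 240), §14.14 (p. 243)] -/

noncomputable section

open scoped NumberField Classical
open NumberField IsDedekindDomain Field PowerSeries WeierstrassCurve
open Literature.NumberTheory.GaloisRepresentations Literature.NumberTheory.GaloisCohomology Literature.NumberTheory.EllipticCurves
  Literature.NumberTheory.EllipticCurves.ModularForms Literature.NumberTheory.QuadraticFields
  Literature.NumberTheory.EllipticCurves.Castella2018 Literature.NumberTheory.EllipticCurves.Kato2004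
  Literature.NumberTheory.EllipticCurves.Rank1Residual
open Summit.BirchSwinnertonDyer.Rank1Residual.Additive (KatoDescentDatum)
open Summit.BirchSwinnertonDyer.BirchSwinnertonDyer.Theses.MordellShaFreeCut
  (AnalyticRankOneOfRankOneFiniteShaThree RankPosOfThreeSelmerCorankOne)
open Summit.BirchSwinnertonDyer.BirchSwinnertonDyer.Theorems.CongruentShaFreeCutKatoDescentDatumOfH2
open Summit.BirchSwinnertonDyer.BirchSwinnertonDyer.Theorems.MordellShaFreeCutKatoZetaRoadPinnedH2 (PRFormulaAtThreeH2)
open Summit.BirchSwinnertonDyer.BirchSwinnertonDyer.Theorems.MordellShaFreeCutThreeAdicBDPTriple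
  (ThreeAdicBDPElementExists ThreeAdicWanDivisibility ThreeAdicBDPValueAtOne)
open Summit.BirchSwinnertonDyer.BirchSwinnertonDyer.Theorems.MordellShaFreeCutThreeAdicBDPExistsValue
  (bdpExistsWithValue_of_exists_of_value)
open Summit.BirchSwinnertonDyer.BirchSwinnertonDyer.Theorems.MordellShaFreeCutKatoBDPReciprocity
  (ThreeAdicKatoBDPReciprocity prFormulaAtThreeH2_of_bdpExistsValue_of_reciprocity)
open Summit.BirchSwinnertonDyer.BirchSwinnertonDyer.Theorems.MordellShaFreeCutBDPWaldspurgerFormula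
  (BDPWaldspurgerFormula threeAdicBDPValueAtOne_of_waldspurger)
open Summit.BirchSwinnertonDyer.BirchSwinnertonDyer.Theorems.MordellShaFreeCutRoadsMeetFromPrint
  (prFormulaAtThreeOddDisc_of_existsOddDisc_of_value_of_reciprocity)
open Summit.BirchSwinnertonDyer.BirchSwinnertonDyer.Theorems.MordellShaFreeCutExistenceFromTwoFacts
  (threeAdicBDPElementExistsOddDisc_of_anyLevel_of_bdp2013 cruxB_of_anyLevel_of_bdp2013_of_value_of_wan
    cruxA_of_res_of_anyLevel_of_bdp2013_of_value_of_wan leaf_of_res_of_anyLevel_of_bdp2013_of_value_of_wan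
    cruxB_of_namedFacts_of_anyLevel_of_bdp2013_of_value_of_reciprocity)
open Summit.BirchSwinnertonDyer.BirchSwinnertonDyer.Theorems.MordellShaFreeCutKatoZetaRoadOddDiscCensus
  (prFormulaOddDisc_of_prFormulaH2 cruxB_of_refereedInputs_of_prFormulaOddDisc)

namespace Summit.BirchSwinnertonDyer.BirchSwinnertonDyer.Theorems.MordellShaFreeCutNamedPropsCensus

/-! ## §1 Perrin-Riou's formula at `3` from existence + the Waldspurger `Prop` + (ERL₃) -/

/-- **PR at the Heegner fields of ODD discriminant ⟸ {(T1) Hsieh 2014 Thm A, BDP13 Thm 5.5} + `BDPWaldspurgerFormula 3` +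
(ERL₃).** The existence half is citation-borne at odd `d_K` (p492305 `threeAdicBDPElementExistsOddDisc_of_anyLevel_of_bdp2013`),
the value half is the Waldspurger `Prop` through p491259 `threeAdicBDPValueAtOne_of_waldspurger`, the comparison is p490456
`prFormulaAtThreeOddDisc_of_existsOddDisc_of_value_of_reciprocity`. CONDITIONAL; closes nothing.
[cite: AlpogeBhargavaShnidman2022, App. A Thm. 10.8 (a) (p. 33)] [cite: BertoliniDarmonPrasanna2013, Thm. 5.13 (shape) and Thm. 5.5] -/
theorem prFormulaOddDisc_of_anyLevel_of_bdp2013_of_waldspurger_of_reciprocity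
    (hT1 : Hsieh2014.thmA_exists_isHsiehLFunction_unrPeriod_anyLevel)
    (hBDP : bertoliniDarmonPrasanna2013_centralValue_reciprocity)
    (hW : BDPWaldspurgerFormula 3) (hERL : ThreeAdicKatoBDPReciprocity) :
    ∀ (W : WeierstrassCurve ℚ) [W.IsElliptic] [W.IsGloballyMinimal]
      [ContinuousSMul ℤ_[3] (W.tateModule 3)], W.j = 0 →
      ∀ (K : Type) [Field K] [NumberField K] (N : ℕ) [NeZero N],
        W.conductorNorm ℤ = N → IsImaginaryQuadratic K → Odd (NumberField.discr K) →
          SatisfiesHeegnerHypothesis N K → SatisfiesHeegnerHypothesis 3 K →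
            (W.quadraticTwist (NumberField.discr K : ℚ)).entireLFunction 1 ≠ 0 →
        ∀ (ι : K →+* ℚ_[3]) (P : (W.baseChange K).toAffine.Point), IsHeegnerPoint N W K P →
          W.entireLFunction 1 = 0 →
        ∀ (D : KatoDescentDatum 3) (pin : KatoDescentDatumPinH2 W 3 D),
          (∃ a b : ℕ,
            Ideal.span {((3 : ℕ) : IwasawaAlgebra 3) ^ a} * Module.charIdeal (IwasawaAlgebra 3) D.H2 =
              Ideal.span {((3 : ℕ) : IwasawaAlgebra 3) ^ b} *
                Module.charIdeal (IwasawaAlgebra 3) (D.H ⧸ (IwasawaAlgebra 3) ∙ D.z)) →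
          ∃ c : ℚ_[3], c ≠ 0 ∧
            HasLocPKummerLog W 3 pin.katoClass (c * padicLogOmega W 3 ι P ^ 2) :=
  prFormulaAtThreeOddDisc_of_existsOddDisc_of_value_of_reciprocity
    (threeAdicBDPElementExistsOddDisc_of_anyLevel_of_bdp2013 hT1 hBDP) (threeAdicBDPValueAtOne_of_waldspurger hW) hERL

/-- **The REGISTERED research stub's type `PRFormulaAtThreeH2` (all Heegner fields) ⟸ (LB-exist) `ThreeAdicBDPElementExists` +
`BDPWaldspurgerFormula 3` + (ERL₃) `ThreeAdicKatoBDPReciprocity`** — ONE named `Prop` per research input (existence / value /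
reciprocity): fold (LB-exist) with the value the Waldspurger `Prop` gives (p478070 `bdpExistsWithValue_of_exists_of_value`), then
p488113 `prFormulaAtThreeH2_of_bdpExistsValue_of_reciprocity`. CONDITIONAL; closes nothing.
[cite: AlpogeBhargavaShnidman2022, App. A Thm. 10.8 (a) (p. 33)] [cite: BertoliniDarmonPrasanna2013, Thm. 5.13 (shape)] -/
theorem prFormulaAtThreeH2_of_exists_of_waldspurger_of_reciprocity (hE : ThreeAdicBDPElementExists)
    (hW : BDPWaldspurgerFormula 3) (hERL : ThreeAdicKatoBDPReciprocity) : PRFormulaAtThreeH2 :=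
  prFormulaAtThreeH2_of_bdpExistsValue_of_reciprocity
    (bdpExistsWithValue_of_exists_of_value hE (threeAdicBDPValueAtOne_of_waldspurger hW)) hERL

/-! ## §2 The kato-zeta road (registered line v1e on 19160) with the named `Prop`s -/

/-- **The v1e bundle `stub_refereedInputs` TOKEN FOR TOKEN ∧ {(T1), BDP13} ∧ `BDPWaldspurgerFormula 3` ∧ (ERL₃) ⟹ crux B** —
the registered kato-zeta line needs Perrin-Riou's formula only at odd `d_K` (p493654 `cruxB_of_refereedInputs_of_prFormulaOddDisc`),
and §1 supplies it there. So modulo ELEVEN citation-borne facts the item's research content on this road is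
{`BDPWaldspurgerFormula 3`, (ERL₃)}. CONDITIONAL; closes nothing.
[cite: AlpogeBhargavaShnidman2022, App. A Thm. 10.1 and §10.1.3 (pp. 33–34)] [cite: Kato2004Asterisque, Thm. 12.4 (p. 221), §14.14 (p. 243)] -/
theorem cruxB_of_refereedInputs_of_anyLevel_of_bdp2013_of_waldspurger_of_reciprocity
    (RI : (∀ (W : WeierstrassCurve ℚ) [W.IsElliptic] (p : ℕ) [Fact p.Prime], p_parity W p) ∧
      ModularForms.exists_isNewformOf ∧
      HoffsteinLuo1997_exists_twist_L_one_ne_zero ∧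
      (∀ (W : WeierstrassCurve ℚ) [W.IsElliptic] (p : ℕ) [Fact p.Prime],
        kato_finite_of_L_one_ne_zero W p) ∧
      (∀ (W : WeierstrassCurve ℚ) (K : Type) [Field K] [NumberField K], exists_isHeegnerPoint W K) ∧
      (∀ (W : WeierstrassCurve ℚ) (N : ℕ) [NeZero N] (K : Type) [Field K] [NumberField K],
        analyticRankEK_eq_one_iff_heegner_nonTorsion W N K) ∧
      nonempty_iwasawaH2Data ∧ thm12_4 ∧ finite_descentCokernel_of_rankOne)
    (hT1 : Hsieh2014.thmA_exists_isHsiehLFunction_unrPeriod_anyLevel)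
    (hBDP : bertoliniDarmonPrasanna2013_centralValue_reciprocity)
    (hW : BDPWaldspurgerFormula 3) (hERL : ThreeAdicKatoBDPReciprocity) :
    AnalyticRankOneOfRankOneFiniteShaThree :=
  cruxB_of_refereedInputs_of_prFormulaOddDisc RI
    (prFormulaOddDisc_of_anyLevel_of_bdp2013_of_waldspurger_of_reciprocity hT1 hBDP hW hERL)

/-- **The v1e bundle TOKEN FOR TOKEN ∧ (LB-exist) ∧ `BDPWaldspurgerFormula 3` ∧ (ERL₃) ⟹ crux B** — the same census with the
existence half as the registered stub (LB-exist) of 19159's sister lines (all Heegner fields) instead of the two named facts;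
route: §1's `PRFormulaAtThreeH2`, restricted to odd `d_K` (p493654 `prFormulaOddDisc_of_prFormulaH2`). CONDITIONAL; closes nothing.
[cite: AlpogeBhargavaShnidman2022, App. A Thm. 10.1 and §10.1.3 (pp. 33–34)] -/
theorem cruxB_of_refereedInputs_of_exists_of_waldspurger_of_reciprocity
    (RI : (∀ (W : WeierstrassCurve ℚ) [W.IsElliptic] (p : ℕ) [Fact p.Prime], p_parity W p) ∧
      ModularForms.exists_isNewformOf ∧
      HoffsteinLuo1997_exists_twist_L_one_ne_zero ∧
      (∀ (W : WeierstrassCurve ℚ) [W.IsElliptic] (p : ℕ) [Fact p.Prime],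
        kato_finite_of_L_one_ne_zero W p) ∧
      (∀ (W : WeierstrassCurve ℚ) (K : Type) [Field K] [NumberField K], exists_isHeegnerPoint W K) ∧
      (∀ (W : WeierstrassCurve ℚ) (N : ℕ) [NeZero N] (K : Type) [Field K] [NumberField K],
        analyticRankEK_eq_one_iff_heegner_nonTorsion W N K) ∧
      nonempty_iwasawaH2Data ∧ thm12_4 ∧ finite_descentCokernel_of_rankOne)
    (hE : ThreeAdicBDPElementExists) (hW : BDPWaldspurgerFormula 3) (hERL : ThreeAdicKatoBDPReciprocity) :
    AnalyticRankOneOfRankOneFiniteShaThree :=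
  cruxB_of_refereedInputs_of_prFormulaOddDisc RI
    (prFormulaOddDisc_of_prFormulaH2 (prFormulaAtThreeH2_of_exists_of_waldspurger_of_reciprocity hE hW hERL))

/-! ## §3 The BDP road (crux B, crux A = registered v6br2 of 19159, the leaf) with the named `Prop`s -/

/-- **Crux B ⟸ six refereed facts + {(T1), BDP13} + `BDPWaldspurgerFormula 3` + (LB-wan) `ThreeAdicWanDivisibility`** —
p492305's `cruxB_of_anyLevel_of_bdp2013_of_value_of_wan` with the value stub fed by the Waldspurger `Prop`. Modulo citation-borne
inputs the item's research content on THIS road is {`BDPWaldspurgerFormula 3`, (LB-wan)}. CONDITIONAL; closes nothing.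
[cite: CastellaGrossiLeeSkinner2022, §5.2 (proof of Thm. 5.2.1)] [cite: BertoliniDarmonPrasanna2013, Thm. 5.13 (shape) and Thm. 5.5] -/
theorem cruxB_of_anyLevel_of_bdp2013_of_waldspurger_of_wan
    (hpar : ∀ (W : WeierstrassCurve ℚ) [W.IsElliptic] (p : ℕ) [Fact p.Prime], p_parity W p)
    (hmod : ModularForms.exists_isNewformOf) (hHL : HoffsteinLuo1997_exists_twist_L_one_ne_zero)
    (hKato : ∀ (W : WeierstrassCurve ℚ) [W.IsElliptic] (p : ℕ) [Fact p.Prime],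
      kato_finite_of_L_one_ne_zero W p)
    (hHP : ∀ (W : WeierstrassCurve ℚ) (K : Type) [Field K] [NumberField K],
      exists_isHeegnerPoint W K)
    (hGZ : ∀ (W : WeierstrassCurve ℚ) (N : ℕ) [NeZero N] (K : Type) [Field K] [NumberField K],
      analyticRankEK_eq_one_iff_heegner_nonTorsion W N K)
    (hT1 : Hsieh2014.thmA_exists_isHsiehLFunction_unrPeriod_anyLevel)
    (hBDP : bertoliniDarmonPrasanna2013_centralValue_reciprocity)
    (hW : BDPWaldspurgerFormula 3) (hWan : ThreeAdicWanDivisibility) :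
    AnalyticRankOneOfRankOneFiniteShaThree :=
  cruxB_of_anyLevel_of_bdp2013_of_value_of_wan hpar hmod hHL hKato hHP hGZ hT1 hBDP
    (threeAdicBDPValueAtOne_of_waldspurger hW) hWan

/-- **Crux A `RankPosOfThreeSelmerCorankOne` ⟸ (res) (the registered `stub_threeLocNonDegeneracy` of 19159, verbatim) + the five
refereed facts of its `stub_refereedInputs` + {(T1), BDP13} + `BDPWaldspurgerFormula 3` + (LB-wan)** — the REGISTERED v6br2
composition `cruxA_of_res_of_anyLevel_of_bdp2013_of_value_of_wan` (p492305) with its value stub `stub_threeAdicBDPValueAtOne` fed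
by the Waldspurger `Prop` (p491259). Research content of 19159 modulo citation-borne inputs: {(res), `BDPWaldspurgerFormula 3`,
(LB-wan)}. CONDITIONAL; closes nothing. [cite: Skinner2020, Thm. B and §2.2–2.3 (shape of (res))]
[cite: BertoliniDarmonPrasanna2013, Thm. 5.13 (shape) and Thm. 5.5] -/
theorem cruxA_of_res_of_anyLevel_of_bdp2013_of_waldspurger_of_wan
    (hpar : ∀ (W : WeierstrassCurve ℚ) [W.IsElliptic] (p : ℕ) [Fact p.Prime], p_parity W p)
    (hmod : ModularForms.exists_isNewformOf) (hHL : HoffsteinLuo1997_exists_twist_L_one_ne_zero)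
    (hKato : ∀ (W : WeierstrassCurve ℚ) [W.IsElliptic] (p : ℕ) [Fact p.Prime],
      kato_finite_of_L_one_ne_zero W p)
    (hHP : ∀ (W : WeierstrassCurve ℚ) (K : Type) [Field K] [NumberField K],
      exists_isHeegnerPoint W K)
    (hres : ∀ (W : WeierstrassCurve ℚ) [W.IsElliptic] [W.IsGloballyMinimal], W.j = 0 →
      ∀ (K : Type) [Field K] [NumberField K],
      IsImaginaryQuadratic K → SatisfiesHeegnerHypothesis 3 K →
        (W.baseChange K).selmerCorank 3 = 1 →
      ∀ (w : HeightOneSpectrum (𝓞 K)), ((3 : ℕ) : 𝓞 K) ∈ w.asIdeal →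
        Finite ↥((W.baseChange K).selmerGroupPInfty 3 ⊓
          selmerLocalKerPrimaryTorsion (W.baseChange K) (w.adicCompletion K) 3))
    (hT1 : Hsieh2014.thmA_exists_isHsiehLFunction_unrPeriod_anyLevel)
    (hBDP : bertoliniDarmonPrasanna2013_centralValue_reciprocity)
    (hW : BDPWaldspurgerFormula 3) (hWan : ThreeAdicWanDivisibility) :
    RankPosOfThreeSelmerCorankOne :=
  cruxA_of_res_of_anyLevel_of_bdp2013_of_value_of_wan hpar hmod hHL hKato hHP hres hT1 hBDP
    (threeAdicBDPValueAtOne_of_waldspurger hW) hWan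

/-- **The rung-S2b leaf `rankOne_threeConverse_mordellCurve` ⟸ {(res), `BDPWaldspurgerFormula 3`, (LB-wan)} + {(T1), BDP13} + six
refereed facts** (route Assembly, p492305's leaf census with the value stub fed by the Waldspurger `Prop`). CONDITIONAL; neither
BSD nor Sylvester's conjecture is touched. [cite: GrossZagier1986, Thm. I.6.3 with V.§2]
[cite: CastellaGrossiLeeSkinner2022, §5.2 (proof of Thm. 5.2.1)] -/
theorem leaf_of_res_of_anyLevel_of_bdp2013_of_waldspurger_of_wan
    (hpar : ∀ (W : WeierstrassCurve ℚ) [W.IsElliptic] (p : ℕ) [Fact p.Prime], p_parity W p)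
    (hmod : ModularForms.exists_isNewformOf) (hHL : HoffsteinLuo1997_exists_twist_L_one_ne_zero)
    (hKato : ∀ (W : WeierstrassCurve ℚ) [W.IsElliptic] (p : ℕ) [Fact p.Prime],
      kato_finite_of_L_one_ne_zero W p)
    (hHP : ∀ (W : WeierstrassCurve ℚ) (K : Type) [Field K] [NumberField K],
      exists_isHeegnerPoint W K)
    (hGZ : ∀ (W : WeierstrassCurve ℚ) (N : ℕ) [NeZero N] (K : Type) [Field K] [NumberField K],
      analyticRankEK_eq_one_iff_heegner_nonTorsion W N K)
    (hres : ∀ (W : WeierstrassCurve ℚ) [W.IsElliptic] [W.IsGloballyMinimal], W.j = 0 →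
      ∀ (K : Type) [Field K] [NumberField K],
      IsImaginaryQuadratic K → SatisfiesHeegnerHypothesis 3 K →
        (W.baseChange K).selmerCorank 3 = 1 →
      ∀ (w : HeightOneSpectrum (𝓞 K)), ((3 : ℕ) : 𝓞 K) ∈ w.asIdeal →
        Finite ↥((W.baseChange K).selmerGroupPInfty 3 ⊓
          selmerLocalKerPrimaryTorsion (W.baseChange K) (w.adicCompletion K) 3))
    (hT1 : Hsieh2014.thmA_exists_isHsiehLFunction_unrPeriod_anyLevel)
    (hBDP : bertoliniDarmonPrasanna2013_centralValue_reciprocity)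
    (hW : BDPWaldspurgerFormula 3) (hWan : ThreeAdicWanDivisibility) :
    rankOne_threeConverse_mordellCurve :=
  leaf_of_res_of_anyLevel_of_bdp2013_of_value_of_wan hpar hmod hHL hKato hHP hGZ hres hT1 hBDP
    (threeAdicBDPValueAtOne_of_waldspurger hW) hWan

/-! ## §4 The joined road, every input a NAMED statement -/

/-- **Crux B ⟸ ELEVEN citation-borne named facts {six refereed theorems; `nonempty_iwasawaH2Data`, `thm12_4`,
`finite_descentCokernel_of_rankOne`; (T1); BDP13} + `BDPWaldspurgerFormula 3` + (ERL₃) `ThreeAdicKatoBDPReciprocity`** — p492305's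
`cruxB_of_namedFacts_of_anyLevel_of_bdp2013_of_value_of_reciprocity` with the ∀-frame value formula fed by the Waldspurger `Prop`:
every hypothesis is ONE named `Prop` of the tree. CONDITIONAL; closes nothing.
[cite: AlpogeBhargavaShnidman2022, App. A Thm. 10.1 and Thm. 10.8 (pp. 33–34)] [cite: Kato2004Asterisque, Thm. 12.4, (14.9.3), §14.14]
[cite: BertoliniDarmonPrasanna2013, Thm. 5.13 (shape) and Thm. 5.5] [cite: Hsieh2014, Thm. A p. 712] -/
theorem cruxB_of_namedFacts_of_anyLevel_of_bdp2013_of_waldspurger_of_reciprocity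
    (hpar : ∀ (W : WeierstrassCurve ℚ) [W.IsElliptic] (p : ℕ) [Fact p.Prime], p_parity W p)
    (hmod : ModularForms.exists_isNewformOf) (hHL : HoffsteinLuo1997_exists_twist_L_one_ne_zero)
    (hKato : ∀ (W : WeierstrassCurve ℚ) [W.IsElliptic] (p : ℕ) [Fact p.Prime],
      kato_finite_of_L_one_ne_zero W p)
    (hHP : ∀ (W : WeierstrassCurve ℚ) (K : Type) [Field K] [NumberField K],
      exists_isHeegnerPoint W K)
    (hGZ : ∀ (W : WeierstrassCurve ℚ) (N : ℕ) [NeZero N] (K : Type) [Field K] [NumberField K],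
      analyticRankEK_eq_one_iff_heegner_nonTorsion W N K)
    (h2 : nonempty_iwasawaH2Data) (h12 : thm12_4) (h31 : finite_descentCokernel_of_rankOne)
    (hT1 : Hsieh2014.thmA_exists_isHsiehLFunction_unrPeriod_anyLevel)
    (hBDP : bertoliniDarmonPrasanna2013_centralValue_reciprocity)
    (hW : BDPWaldspurgerFormula 3) (hERL : ThreeAdicKatoBDPReciprocity) :
    AnalyticRankOneOfRankOneFiniteShaThree :=
  cruxB_of_namedFacts_of_anyLevel_of_bdp2013_of_value_of_reciprocity hpar hmod hHL hKato hHP hGZ h2 h12 h31 hT1 hBDP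
    (threeAdicBDPValueAtOne_of_waldspurger hW) hERL

end Summit.BirchSwinnertonDyer.BirchSwinnertonDyer.Theorems.MordellShaFreeCutNamedPropsCensus

end
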